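import Literature.RingTheory.Idempotents.InvariantsOfPermutedBlocksNormal
import Literature.RingTheory.Idempotents.PrimitiveIdempotentsOfReducedNoetherian
import Literature.AlgebraicGeometry.Resolution.NormalOneDimensionalSmooth
import Literature.AlgebraicGeometry.Resolution.FiniteQuotientSingularityPresentation
import Literature.RingTheory.KrullDimension.AffineDimension
import Mathlib.Algebra.Algebra.Pi
import HarnessLib

/-!
# The ring of invariants of a finite group acting on a normal one-dimensional algebra over a perfect field is smooth
# ([KnusEtAl1998] proof of Prop. (18.18); [AtiyahMacdonald1969] Ex. 5.12–5.14; [GortzWedhorn2020] Prop. 6.40 / Thm. 6.28)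

Topic `Literature/RingTheory/Idempotents`, namespace `Literature.RingTheory.Idempotents`.  PROOF FILE (theorems only; no
definition, no instance, no notation, no named fact, no `sorry`).  Cell `hodgecm-mathlib` (D-0151), FLOOR 0, programme F0P5a
(D9op road 2′, crux item stmt-HodgeConjecture-24832), MOD-PLAN L6.6 FILE 2a cut (B-p16 (g20) 02:25:23Z, F0P5a-plan (g2) ruling
02:25:33Z): the **RING COMPOSITE (R)** consumed verbatim by the scheme file `RelativeSpec/GeometricQuotientSmoothCurveField`
(the fibre `X_y ∕ G → Spec κ(y)` of a tame finite-group quotient of a smooth relative curve is smooth of relative dimension 1).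

SETTING.  `l` a PERFECT field; `A` a reduced `l`-algebra of finite type which is NORMAL of dimension `≤ 1` — every localisation
at a maximal ideal is an integrally closed DOMAIN and `dim A ≤ 1` (the coordinate ring of a `G`-stable affine chart of a smooth,
possibly disconnected, curve over `l`); `G` a finite group acting on `A` by `l`-algebra automorphisms (`MulSemiringAction G A`,
`SMulCommClass G l A`).  CONCLUSION: `A^G = FixedPoints.subalgebra l A G` is SMOOTH over `l`.

ROAD (all inputs ★ by name).  The primitive idempotents of `A` are finitely many, form a complete orthogonal family and have
integrally closed DOMAIN blocks (★ N2 `blocks_isDomain_and_isIntegrallyClosed`, F0P5a-p04); `G` permutes them (★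
`isPrimitiveIdempotent_smul_iff`); the orbit sums `ε_k`, `k ∈ {primitive idempotents}∕G`, are a complete orthogonal family of `A^G`
(★ `exists_completeOrthogonalIdempotents_fixedPoints_orbitSum`, F0P1a-p03) whose blocks `A^G ⧸ (1 - ε_k) ≅ B^H` are integrally
closed domains (★ `isDomain_and_isIntegrallyClosed_orbitBlock_of_blocks`, [KnusEtAl1998] (18.18): `(∏_{G∕H} B)^G ≃ B^H`); so
`A^G ≃ₐ[l] ∏_k A^G ⧸ (1 - ε_k)` (Mathlib `CompleteOrthogonalIdempotents.bijective_pi`), each factor of finite type over `l` (E. Noether, ★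
`finiteType_fixedPointsSubalgebra`) and of dimension `≤ dim A^G = dim A ≤ 1` (`A` integral over `A^G`, ★ `ringKrullDim_eq_of_isIntegral`;
Mathlib `ringKrullDim_quotient_le`); hence smooth by the product form of «normal one-dimensional over a perfect field ⇒ smooth» (★ N1
`NormalCurve.smooth_of_algEquiv_pi`, F0P5a-p03).

* §1 `fixedPointsSubringEquivSubalgebra`-free transport: `ringEquiv_fixedPoints_subring_subalgebra` (the identity `A^G` (subring) `≃+*`
  `A^G` (subalgebra)) and the dimension ∕ finiteness facts `ringKrullDim_fixedPointsSubalgebra_le`, `krullDimLE_quotient_fixedPointsSubalgebra`.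
* §2 **`smooth_fixedPointsSubalgebra_of_normal_of_ringKrullDim_le_one`** — the head, SIGNATURE VERBATIM as cut by B-p16 (g20).

HC_CM is proved only modulo the 7 printed citations until rung 0 closes; this file is generic commutative algebra and changes no count.

## References
* [KnusEtAl1998] M.-A. Knus, A. Merkurjev, M. Rost, J.-P. Tignol, *The Book of Involutions*, AMS Coll. Publ. 44 (1998), §18.B,
  proof of Prop. (18.18) (p. 366).
* [AtiyahMacdonald1969] M. F. Atiyah, I. G. Macdonald, *Introduction to Commutative Algebra* (1969), Ch. 5, Exercises 5.12–5.14
  (rings of invariants of finite groups: integrality, normality), Ch. 7 Ex. (Noether finiteness).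
* [GortzWedhorn2020] U. Görtz, T. Wedhorn, *Algebraic Geometry I* (2nd ed. 2020): Prop. 6.40, Thm. 6.28.
-/

set_option autoImplicit false

namespace Literature.RingTheory.Idempotents

universe u

open IsLocalRing

/-! ### §1 Transport between the two presentations of the invariants, dimension and finiteness -/

section Transport

variable (l A : Type u) [Field l] [CommRing A] [Algebra l A] (G : Type u) [Group G] [MulSemiringAction G A]
  [SMulCommClass G l A]

/-- The ring of invariants as a subring (Mathlib `FixedPoints.subring`, the currency of ★ `InvariantsOfPermutedBlocks`) and as an
`l`-subalgebra (Mathlib `FixedPoints.subalgebra`) have the same elements: the identity is a ring isomorphism.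
[cite: AtiyahMacdonald1969, Ch. 5 Ex. 5.12] -/
theorem exists_ringEquiv_fixedPoints_subring_subalgebra :
    ∃ e : FixedPoints.subring A G ≃+* FixedPoints.subalgebra l A G, ∀ x, (e x : A) = (x : A) :=
  ⟨{ toFun := fun x => ⟨(x : A), fun g => x.2 g⟩
     invFun := fun x => ⟨(x : A), fun g => x.2 g⟩
     left_inv := fun _ => rfl
     right_inv := fun _ => rfl
     map_mul' := fun _ _ => rfl
     map_add' := fun _ _ => rfl }, fun _ => rfl⟩

/-- **`dim A^G = dim A`** for a finite group: `A` is integral over `A^G` (★ `isIntegral_fixedPointsSubalgebra`) and `A^G ⊆ A`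
(★ `KrullDimension.ringKrullDim_eq_of_isIntegral`). [cite: AtiyahMacdonald1969, Ch. 5 Ex. 5.12] -/
theorem ringKrullDim_fixedPointsSubalgebra_eq [Finite G] :
    ringKrullDim (FixedPoints.subalgebra l A G) = ringKrullDim A :=
  Literature.RingTheory.KrullDimension.ringKrullDim_eq_of_isIntegral
    (R := FixedPoints.subalgebra l A G) (S := A) Subtype.val_injective

/-- Hence every quotient of `A^G` has dimension `≤ dim A` (Mathlib `ringKrullDim_quotient_le`); in class form for `dim A ≤ 1`.
[cite: AtiyahMacdonald1969, Ch. 5 Ex. 5.12] -/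
theorem krullDimLE_one_quotient_fixedPointsSubalgebra [Finite G] (hdim : ringKrullDim A ≤ 1)
    (I : Ideal (FixedPoints.subalgebra l A G)) : Ring.KrullDimLE 1 (FixedPoints.subalgebra l A G ⧸ I) :=
  Ring.krullDimLE_iff.mpr
    ((ringKrullDim_quotient_le I).trans ((ringKrullDim_fixedPointsSubalgebra_eq l A G).le.trans hdim))

end Transport

/-! ### §2 The ring composite: smoothness of the invariants -/

section Smooth

/-- **The invariants of a finite group acting on a normal one-dimensional algebra of finite type over a perfect field are smooth**
(FILE 2a cut (R), signature verbatim).  `l` perfect; `A` reduced, of finite type over `l`, with `dim A ≤ 1` and every localisation at a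
maximal ideal an integrally closed domain; `G` finite acting by `l`-algebra automorphisms.  Then `Algebra.Smooth l (A^G)`.
Proof: primitive idempotents of `A` (finite, complete orthogonal, integrally closed domain blocks — ★ N2) are permuted by `G`; their orbit
sums are a complete orthogonal family `ε` of `A^G` whose blocks are integrally closed domains (★ B2-alg, [KnusEtAl1998] (18.18)); so
`A^G ≃ₐ[l] ∏_k A^G ⧸ (1 - ε_k)` with factors of finite type (Noether) and dimension `≤ 1`, and ★ N1 `NormalCurve.smooth_of_algEquiv_pi`
concludes. [cite: KnusEtAl1998, Prop. (18.18) (proof)] [cite: GortzWedhorn2020, Prop. 6.40] [cite: AtiyahMacdonald1969, Ch. 5 Ex. 5.12] -/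
theorem smooth_fixedPointsSubalgebra_of_normal_of_ringKrullDim_le_one (l A : Type u) [Field l] [PerfectField l]
    [CommRing A] [Algebra l A] [Algebra.FiniteType l A] [IsReduced A] (G : Type u) [Group G] [Finite G]
    [MulSemiringAction G A] [SMulCommClass G l A]
    (hdom : ∀ m : Ideal A, [m.IsMaximal] → IsDomain (Localization.AtPrime m))
    (hic : ∀ m : Ideal A, [m.IsMaximal] → IsIntegrallyClosed (Localization.AtPrime m))
    (hdim : ringKrullDim A ≤ 1) : Algebra.Smooth l ↥(FixedPoints.subalgebra l A G) := by
  classical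
  haveI : IsNoetherianRing A := Algebra.FiniteType.isNoetherianRing l A
  -- the primitive idempotents of `A`: finite, complete orthogonal, integrally closed domain blocks
  obtain ⟨hfin, hcoi, hblk⟩ := blocks_isDomain_and_isIntegrallyClosed (A := A) hdom hic
  haveI : Finite {f : A // IsPrimitiveIdempotent f} := hfin.to_subtype
  letI : Fintype {f : A // IsPrimitiveIdempotent f} := Fintype.ofFinite _
  have he : CompleteOrthogonalIdempotents (Subtype.val : {f : A // IsPrimitiveIdempotent f} → A) := hcoi
  -- `G` permutes them
  letI : MulAction G {f : A // IsPrimitiveIdempotent f} :=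
    { smul := fun g f => ⟨g • (f : A), (isPrimitiveIdempotent_smul_iff g).2 f.2⟩
      one_smul := fun f => Subtype.ext (one_smul G (f : A))
      mul_smul := fun g g' f => Subtype.ext (mul_smul g g' (f : A)) }
  have hge : ∀ (g : G) (i : {f : A // IsPrimitiveIdempotent f}),
      g • (i : A) = ((g • i : {f : A // IsPrimitiveIdempotent f}) : A) := fun _ _ => rfl
  -- the orbit blocks of the subring of invariants
  obtain ⟨ε', hε', hε'val⟩ := exists_completeOrthogonalIdempotents_fixedPoints_orbitSum he hge
  have hblocks : ∀ k, IsDomain (FixedPoints.subring A G ⧸ Ideal.span {1 - ε' k}) ∧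
      IsIntegrallyClosed (FixedPoints.subring A G ⧸ Ideal.span {1 - ε' k}) := fun k =>
    isDomain_and_isIntegrallyClosed_orbitBlock_of_blocks he hge (fun i => hblk i.1 i.2) k (ε' k) (hε'val k)
  -- transport to the subalgebra
  obtain ⟨eR, heR⟩ := exists_ringEquiv_fixedPoints_subring_subalgebra l A G
  let ε : MulAction.orbitRel.Quotient G {f : A // IsPrimitiveIdempotent f} → FixedPoints.subalgebra l A G :=
    fun k => eR (ε' k)
  have hε : CompleteOrthogonalIdempotents ε :=
    (CompleteOrthogonalIdempotents.map_injective_iff (f := eR.toRingHom) eR.injective).mpr hε'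
  -- the blocks of `A^G`
  let C : MulAction.orbitRel.Quotient G {f : A // IsPrimitiveIdempotent f} → Type u :=
    fun k => FixedPoints.subalgebra l A G ⧸ Ideal.span {1 - ε k}
  have eC : ∀ k, (FixedPoints.subring A G ⧸ Ideal.span {1 - ε' k}) ≃+* C k := fun k =>
    Ideal.quotientEquiv (Ideal.span {1 - ε' k}) (Ideal.span {1 - ε k}) eR (by
      rw [Ideal.map_span, Set.image_singleton, map_sub, map_one]
      rfl)
  haveI : ∀ k, IsDomain (C k) := fun k =>
    haveI := (hblocks k).1
    MulEquiv.isDomain (FixedPoints.subring A G ⧸ Ideal.span {1 - ε' k}) (eC k).symm.toMulEquiv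
  haveI : ∀ k, IsIntegrallyClosed (C k) := fun k =>
    haveI := (hblocks k).1
    haveI := (hblocks k).2
    IsIntegrallyClosed.of_equiv (eC k)
  haveI : ∀ k, Ring.KrullDimLE 1 (C k) := fun k =>
    krullDimLE_one_quotient_fixedPointsSubalgebra l A G hdim _
  -- `A^G ≃ₐ[l] ∏_k C k`
  let π : FixedPoints.subalgebra l A G →ₐ[l] (Π k, C k) :=
    AlgHom.pi fun k => Ideal.Quotient.mkₐ l (Ideal.span {1 - ε k})
  have hπ : Function.Bijective π := hε.bijective_pi
  exact Literature.AlgebraicGeometry.Resolution.NormalCurve.smooth_of_algEquiv_pi l C (AlgEquiv.ofBijective π hπ)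

end Smooth

end Literature.RingTheory.Idempotents
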